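import Summits.CriticalPhenomena.PercolationContinuityZ3.Theorems.Transplant.Slab111SKFinalK4
import Summits.CriticalPhenomena.PercolationContinuityZ3.Theorems.Transplant.Slab111SKFinalK5
import Summits.CriticalPhenomena.PercolationContinuityZ3.Theorems.Transplant.Slab111SKFinalK6
import Summits.CriticalPhenomena.PercolationContinuityZ3.Theorems.Transplant.Slab111SKFinalK7
import Summits.CriticalPhenomena.PercolationContinuityZ3.Theorems.Transplant.Slab111SKFinalK8
import Summits.CriticalPhenomena.PercolationContinuityZ3.Theorems.Transplant.Slab111SKFinalK9
import Summits.CriticalPhenomena.PercolationContinuityZ3.Theorems.Transplant.Slab111HubXFinal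
import HarnessLib

/-!
# The `(111)`-films of EVERY thickness `k ≥ 4` die at their own critical point — independently of p205010

builds on p205010 (kernel theorem, internal audit signed; external expert review pending) — NOT used in this file or anywhere in its import cone: this is the
p205010-INDEPENDENT certification of `Slab111OwnCriticalContinuity k` for every `k ≥ 4` (the by-name node is also closed for every `k` via p205010 in
«Slab111OwnCriticalContinuityHolds»).  Lane `prim-bschramm`, seat `prim-bschramm-p2` (gen 38; class C1b; memo `HOME/bschramm/P2-LATTICES.md` §136); helper file
(`--supports stmt-CriticalPhenomena-4575 --as helper`).
`ShapedLinkage 3 (Slab111.hexShadow k)` — DST's "three disjoint paths" instance obligation of the hexagonal-shadow transplant — holds for `4 ≤ k ≤ 9` by the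
kernel bitboard certificates «Slab111SKFinalK4» … «Slab111SKFinalK9» (gen 38) and for `k ≥ 10` by the zone-free hub dispatcher «Slab111HubXFinal» (gen 37):
**`Slab111.shapedLinkage_three_of_four_le`**, hence **`slab111OwnCriticalContinuity_of_four_le`** («HexShadowVLinkageNode»).  Open by this route: `k = 3`
(92 certified terminal triples of the thinnest clipped blocks admit no swap pair with the gen-34 cleared sets) and `k = 2` (the dice lattice: planar, no swap
pairs); `k = 1` is the honeycomb lattice («Slab111Honeycomb», in print).
[cite: DuminilCopinSidoraviciusTassion2016, Thm. 1, §2.3 (proof of Fact 2)] [cite: BenjaminiSchramm1996, Conj. 4 / Question 3]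
-/

noncomputable section

namespace Summit.CriticalPhenomena.PercolationContinuityZ3.Theorems.Transplant

open Literature.Probability.Percolation Literature.Probability.LatticeModels SimpleGraph

/-- **SHAPED LOCAL LINKAGE OF THE `(111)`-FILMS, surgery radius `3`, EVERY thickness `k ≥ 4`.** [cite: DuminilCopinSidoraviciusTassion2016, §2.3 (proof of Fact 2)] -/
theorem Slab111.shapedLinkage_three_of_four_le {k : ℕ} (hk : 4 ≤ k) : (Slab111.hexShadow k).ShapedLinkage 3 := by
  rcases Nat.lt_or_ge k 10 with h10 | h10
  · interval_cases k
    · exact Slab111.shapedLinkage_three_k4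
    · exact Slab111.shapedLinkage_three_k5
    · exact Slab111.shapedLinkage_three_k6
    · exact Slab111.shapedLinkage_three_k7
    · exact Slab111.shapedLinkage_three_k8
    · exact Slab111.shapedLinkage_three_k9
  · exact Slab111.shapedLinkage_three_ten h10

/-- **THE `(111)`-FILM `{0 ≤ x₀+x₁+x₂ ≤ k}` OF `ℤ³` DIES AT ITS OWN CRITICAL POINT FOR EVERY `k ≥ 4` — independently of p205010** (Duminil-Copin–Sidoravicius–Tassion's
slab argument transplanted to the hexagonal shadow, with the instance's local linkage certified by the kernel).
[cite: DuminilCopinSidoraviciusTassion2016, Thm. 1, §2.3] [cite: BenjaminiSchramm1996, Conj. 4 / Question 3] -/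
theorem slab111OwnCriticalContinuity_of_four_le {k : ℕ} (hk : 4 ≤ k) : Slab111OwnCriticalContinuity k :=
  slab111OwnCriticalContinuity_of_shapedLinkage (by omega) (Slab111.shapedLinkage_three_of_four_le hk)

end Summit.CriticalPhenomena.PercolationContinuityZ3.Theorems.Transplant

end
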